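import Summits.CriticalPhenomena.PercolationContinuityZ3.Theorems.SahiMasterFamilyFivePrelim

/-!
# The order-five identities (any weight): shrinking one or two slots of an independent frame

Unit `prim-master-conj` (crux anchor stmt-CriticalPhenomena-4575).  THIS FILE: the two weight-free identities `sahiE_five_eq_of_frame_shrink`,
`sahiE_five_eq_of_two_shrinks` (and the annihilator evaluations they rest on); the events-level positivity theorem is
`SahiMasterFamilyFiveStep.lean`.  Context: `SahiMasterFamilyFourStep.lean` proved the order-four
step (both halves) from the sandwich structure of `Z_3`.  Its zero analysis (`supports_of_sahiE_four_eq_zero`) describes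
`Z_4`: with `(X, Y, G)` the `Z_3` sub-triple via `(X, Y)`, `K ⊇ G` the forced-open hull and `N = K ∖ G`,
 (a) `K = G` — then `(X, Y, K)` is an independent frame and the fourth event `D` agrees with ITS hull `K_D` on the three
     pairwise intersections (`inter_inter_hull_subset`), i.e. `N_D = K_D ∖ D` kills the pairwise products; or
 (b) `D` is `Z_3`-sandwiched over `(X, Y)` as well, with hull `K'` independent of `K`.
By multilinearity in the shrunk slots and the annihilator identities (`SahiMasterFamilyAnnihilator.lean`,
`sahiE_five_of_pairwise_annihilator`), for ANY weight (`sahiE_five_eq_of_frame_shrink`, `sahiE_five_eq_of_two_shrinks`):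
 (a) `E_5(D,K,W,X,Y) = E_5(K_D,K,W,X,Y) + E(N_D K)E_3(W,X,Y) + E(N_D X)E_3(W,K,Y) + E(N_D Y)E_3(W,K,X) + E(N_D)E_4(K,W,X,Y)`,
 (b) `E_5(G,D,W,X,Y) = E_5(K,K',W,X,Y) + E(N)E_4(K',W,X,Y) + E(N')E_4(K,W,X,Y) + [E(NK') + E(N'K) + E(N)E(N') − E(NN')]·E_3(W,X,Y)`,
every `E` on the right being an independent-frame functional (`sahiE_ind_nonneg_of_frame`, order-four step, independent
pair), every coefficient nonnegative.  HENCE (`sahiE_five_ind_nonneg_of_zeroFlagQuadruple`): **Sahi's `E_5(μ_p; U) ≥ 0` for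
every 5-family of increasing events `U` containing a `Z_4` sub-family, every `p ∈ [0,1]^ι`** — the order-five case of
`MasterFamilyNonneg` on such families, with no order-3/4 conjecture as input.  No conjecture asserted; axioms standard. [this work]
-/

noncomputable section

open scoped Classical

namespace Summit.CriticalPhenomena.PercolationContinuityZ3.Theorems

open Finset Function MeasureTheory
open Literature.Combinatorics.Sahi2008
open Literature.Probability.Percolation (DeterminedBy)
open Literature.Probability.LatticeModels (prodBernoulli)
open Literature.Probability.LatticeModels.Kahn2022 (Affects)
open Literature.Probability.Percolation.DecisionTree (ind ind_of_mem ind_of_not_mem ind_nonneg)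

/-! ### The two abstract identities (any weight, any functions) -/

section Abstract

variable {α : Type*} [Fintype α]

/-- Two free slots (private copy of the appended `SahiMasterFamilyAnnihilator` lemma): if `F_j · h = 0` for all `j`,
`E_{n+4}(h, D₁, D₂, F) = −E(h)E_{n+3}(D₁,D₂,F) − E(hD₁)E_{n+2}(D₂,F) − E(hD₂)E_{n+2}(D₁,F) − 2E(hD₁D₂)E_{n+1}(F)`. [this work] -/
private theorem twoFree (μ : α → ℝ) (n : ℕ) (h D₁ D₂ : α → ℝ) (F : Fin (n + 1) → α → ℝ)
    (hann : ∀ j, F j * h = 0) :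
    sahiE μ (n + 4) (Fin.cons h (Fin.cons D₁ (Fin.cons D₂ F)) : Fin (n + 4) → α → ℝ) =
      -(sahiE μ (n + 3) (Fin.cons D₁ (Fin.cons D₂ F) : Fin (n + 3) → α → ℝ) * ex μ h)
        - sahiE μ (n + 2) (Fin.cons D₂ F : Fin (n + 2) → α → ℝ) * ex μ (D₁ * h)
        - sahiE μ (n + 2) (Fin.cons D₁ F : Fin (n + 2) → α → ℝ) * ex μ (D₂ * h)
        - 2 * (sahiE μ (n + 1) F * ex μ (D₁ * D₂ * h)) := by
  have hD₁ : ∀ j, F j * (D₁ * h) = 0 := fun j => by rw [mul_left_comm, hann j, mul_zero]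
  have hD₂ : ∀ j, F j * (D₂ * h) = 0 := fun j => by rw [mul_left_comm, hann j, mul_zero]
  have h12 : ∀ j, F j * (D₂ * h * D₁) = 0 := fun j => by rw [← mul_assoc, hD₂ j, zero_mul]
  have hB : sahiE μ (n + 3) (Fin.cons D₁ (Fin.cons (D₂ * h) F) : Fin (n + 3) → α → ℝ) =
      -(sahiE μ (n + 1) F * ex μ (D₁ * D₂ * h))
        - sahiE μ (n + 2) (Fin.cons D₁ F : Fin (n + 2) → α → ℝ) * ex μ (D₂ * h) := by
    rw [sahiE_fin_cons, Fin.sum_univ_succ, Fin.update_cons_zero, Fin.cons_zero,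
      SahiMeetTowerAll.sahiE_cons_of_mul_eq_zero μ n (D₂ * h * D₁) F h12,
      SahiMeetTowerAll.sahiE_cons_of_mul_eq_zero μ n (D₂ * h) F hD₂, sahiE_fin_cons μ n D₁ F]
    have hk : ∀ k : Fin (n + 1), sahiE μ (n + 2)
        (update (Fin.cons (D₂ * h) F : Fin (n + 2) → α → ℝ) k.succ
          ((Fin.cons (D₂ * h) F : Fin (n + 2) → α → ℝ) k.succ * D₁)) =
        -(sahiE μ (n + 1) (update F k (F k * D₁)) * ex μ (D₂ * h)) := fun k => by
      rw [Fin.cons_succ, ← Fin.cons_update]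
      refine SahiMeetTowerAll.sahiE_cons_of_mul_eq_zero μ n (D₂ * h) _ fun j => ?_
      by_cases hj : j = k
      · subst hj
        rw [update_self, mul_right_comm, hD₂ j, zero_mul]
      · rw [update_of_ne hj, hD₂ j]
    simp only [hk, sum_neg_distrib, ← sum_mul]
    have hm : D₂ * h * D₁ = D₁ * D₂ * h := by rw [mul_comm, ← mul_assoc]
    rw [hm]
    ring
  have hz : ∀ k : Fin (n + 1), sahiE μ (n + 3)
      (update (Fin.cons D₁ (Fin.cons D₂ F) : Fin (n + 3) → α → ℝ) k.succ.succ
        ((Fin.cons D₁ (Fin.cons D₂ F) : Fin (n + 3) → α → ℝ) k.succ.succ * h)) = 0 := fun k => by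
    rw [Fin.cons_succ, Fin.cons_succ, hann k]; exact sahiE_update_zero μ _ _
  rw [sahiE_fin_cons, Fin.sum_univ_succ, Fin.sum_univ_succ, Fin.update_cons_zero, Fin.cons_zero,
    Fin.cons_succ, Fin.cons_zero, ← Fin.cons_update, Fin.update_cons_zero,
    sahiE_cons_cons_of_mul_eq_zero μ n (D₁ * h) D₂ F hD₁, hB]
  simp only [hz, sum_const_zero, add_zero]
  have hm' : D₂ * (D₁ * h) = D₁ * D₂ * h := by rw [mul_left_comm, mul_assoc]
  rw [hm']
  ring

omit [Fintype α] in
/-- Vector forms of the `cons` families used below. [folklore] -/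
private theorem vec5_eq_cons (a b c d e : α → ℝ) :
    (![a, b, c, d, e] : Fin 5 → α → ℝ) = Fin.cons a (Fin.cons b (Fin.cons c ![d, e])) := by
  funext j; fin_cases j <;> rfl

omit [Fintype α] in
/-- Vector/`cons` form at order four. [folklore] -/
private theorem vec4_eq_cons (a b c d : α → ℝ) :
    (![a, b, c, d] : Fin 4 → α → ℝ) = Fin.cons a (Fin.cons b ![c, d]) := by
  funext j; fin_cases j <;> rfl

omit [Fintype α] in
/-- Vector/`cons` form at order three. [folklore] -/
private theorem vec3_eq_cons (a b c : α → ℝ) : (![a, b, c] : Fin 3 → α → ℝ) = Fin.cons a ![b, c] := by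
  funext j; fin_cases j <;> rfl

/-- `E_5(n, d₁, d₂, x, y)` for an annihilator `n` of `x, y` with `E_2(x,y) = 0`:
`= −E(n)E_4(d₁,d₂,x,y) − E(nd₁)E_3(d₂,x,y) − E(nd₂)E_3(d₁,x,y)`. [this work] -/
theorem sahiE_five_of_annihilator_pair (μ : α → ℝ) (n d₁ d₂ x y : α → ℝ) (hx : x * n = 0) (hy : y * n = 0)
    (e2 : sahiE μ 2 ![x, y] = 0) :
    sahiE μ 5 ![n, d₁, d₂, x, y] = -(ex μ n * sahiE μ 4 ![d₁, d₂, x, y]) - ex μ (d₁ * n) * sahiE μ 3 ![d₂, x, y]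
      - ex μ (d₂ * n) * sahiE μ 3 ![d₁, x, y] := by
  have hann : ∀ j : Fin 2, (![x, y] : Fin 2 → α → ℝ) j * n = 0 := by
    intro j; fin_cases j
    · exact hx
    · exact hy
  rw [vec5_eq_cons, twoFree μ 1 n d₁ d₂ ![x, y] hann, e2, ← vec4_eq_cons, ← vec3_eq_cons, ← vec3_eq_cons]
  ring

/-- `E_4(n, d, x, y) = −E(n)E_3(d,x,y)` and `E_3(n, x, y) = 0` for an annihilator `n` of `x, y` with `E_2(x,y) = 0`.
[this work] -/
theorem sahiE_four_three_of_annihilator_pair (μ : α → ℝ) (n d x y : α → ℝ) (hx : x * n = 0) (hy : y * n = 0)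
    (e2 : sahiE μ 2 ![x, y] = 0) :
    sahiE μ 4 ![n, d, x, y] = -(ex μ n * sahiE μ 3 ![d, x, y]) ∧ sahiE μ 3 ![n, x, y] = 0 := by
  have hann : ∀ j : Fin 2, (![x, y] : Fin 2 → α → ℝ) j * n = 0 := by
    intro j; fin_cases j
    · exact hx
    · exact hy
  constructor
  · rw [vec4_eq_cons, sahiE_cons_cons_of_mul_eq_zero μ 1 n d ![x, y] hann, e2, ← vec3_eq_cons]; ring
  · rw [vec3_eq_cons, SahiMeetTowerAll.sahiE_cons_of_mul_eq_zero μ 1 n ![x, y] hann, e2]; ring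

/-- **Case (b) identity, any weight.**  If `g = k − n`, `d = k' − n'`, the annihilators `n, n'` kill `x` and `y`, and the
frames satisfy `E_2(x,y) = E_3(k,x,y) = E_3(k',x,y) = 0`, then
`E_5(g,d,w,x,y) = E_5(k,k',w,x,y) + E(n)E_4(k',w,x,y) + E(n')E_4(k,w,x,y) + [E(k'n) + E(kn') + E(n)E(n') − E(nn')]·E_3(w,x,y)`.
[this work] -/
theorem sahiE_five_eq_of_two_shrinks (μ : α → ℝ) (g d w x y k k' n n' : α → ℝ) (hg : g = k - n) (hd : d = k' - n')
    (hxn : x * n = 0) (hyn : y * n = 0) (hxn' : x * n' = 0) (hyn' : y * n' = 0) (e2 : sahiE μ 2 ![x, y] = 0)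
    (e3k : sahiE μ 3 ![k, x, y] = 0) (e3k' : sahiE μ 3 ![k', x, y] = 0) :
    sahiE μ 5 ![g, d, w, x, y] = sahiE μ 5 ![k, k', w, x, y] + ex μ n * sahiE μ 4 ![k', w, x, y]
      + ex μ n' * sahiE μ 4 ![k, w, x, y]
      + (ex μ (k' * n) + ex μ (k * n') + ex μ n * ex μ n' - ex μ (n * n')) * sahiE μ 3 ![w, x, y] := by
  -- multilinearity in slot 0 and slot 1
  have u0 : ∀ (f b : α → ℝ), (![f, b, w, x, y] : Fin 5 → α → ℝ) = update ![g, b, w, x, y] 0 f := fun f b => by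
    funext j; fin_cases j <;> rfl
  have u1 : ∀ (a f : α → ℝ), (![a, f, w, x, y] : Fin 5 → α → ℝ) = update ![a, d, w, x, y] 1 f := fun a f => by
    funext j; fin_cases j <;> rfl
  have lin0 : ∀ b : α → ℝ, sahiE μ 5 ![g, b, w, x, y] = sahiE μ 5 ![k, b, w, x, y] - sahiE μ 5 ![n, b, w, x, y] := by
    intro b
    have key := sahiE_update_lin μ 5 (![g, b, w, x, y]) 0 1 (-1) k n
    rw [← u0, ← u0, ← u0, show (1 : ℝ) • k + (-1 : ℝ) • n = g by rw [hg, one_smul, neg_one_smul]; abel] at key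
    rw [key]; ring
  have lin1 : ∀ a : α → ℝ, sahiE μ 5 ![a, d, w, x, y] = sahiE μ 5 ![a, k', w, x, y] - sahiE μ 5 ![a, n', w, x, y] := by
    intro a
    have key := sahiE_update_lin μ 5 (![a, d, w, x, y]) 1 1 (-1) k' n'
    rw [← u1, ← u1, ← u1, show (1 : ℝ) • k' + (-1 : ℝ) • n' = d by rw [hd, one_smul, neg_one_smul]; abel] at key
    rw [key]; ring
  rw [lin0, lin1, lin1, sahiE_five_swap01 μ k n', sahiE_five_of_annihilator_pair μ n k' w x y hxn hyn e2,
    sahiE_five_of_annihilator_pair μ n' k w x y hxn' hyn' e2, sahiE_five_of_annihilator_pair μ n n' w x y hxn hyn e2,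
    (sahiE_four_three_of_annihilator_pair μ n' w x y hxn' hyn' e2).1,
    (sahiE_four_three_of_annihilator_pair μ n' w x y hxn' hyn' e2).2, e3k, e3k']
  have hc : n' * n = n * n' := mul_comm _ _
  rw [hc]
  ring

/-- **Case (a) identity, any weight.**  If `d = k_d − n_d` where `n_d` kills the pairwise products of the frame `k, x, y`
(`E_2` of its pairs and `E_3(k,x,y)` vanishing), then
`E_5(d,k,w,x,y) = E_5(k_d,k,w,x,y) + E(kn_d)E_3(w,x,y) + E(xn_d)E_3(w,k,y) + E(yn_d)E_3(w,k,x) + E(n_d)E_4(k,w,x,y)`. [this work] -/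
theorem sahiE_five_eq_of_frame_shrink (μ : α → ℝ) (d k w x y kd nd : α → ℝ) (hd : d = kd - nd)
    (hkx : k * x * nd = 0) (hky : k * y * nd = 0) (hxy : x * y * nd = 0) (e2xy : sahiE μ 2 ![x, y] = 0)
    (e2kx : sahiE μ 2 ![k, x] = 0) (e2ky : sahiE μ 2 ![k, y] = 0) (e3 : sahiE μ 3 ![k, x, y] = 0) :
    sahiE μ 5 ![d, k, w, x, y] = sahiE μ 5 ![kd, k, w, x, y] + ex μ (k * nd) * sahiE μ 3 ![w, x, y]
      + ex μ (x * nd) * sahiE μ 3 ![w, k, y] + ex μ (y * nd) * sahiE μ 3 ![w, k, x]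
      + ex μ nd * sahiE μ 4 ![k, w, x, y] := by
  have u0 : ∀ f : α → ℝ, (![f, k, w, x, y] : Fin 5 → α → ℝ) = update ![d, k, w, x, y] 0 f := fun f => by
    funext j; fin_cases j <;> rfl
  have key := sahiE_update_lin μ 5 (![d, k, w, x, y]) 0 1 (-1) kd nd
  rw [← u0, ← u0, ← u0, show (1 : ℝ) • kd + (-1 : ℝ) • nd = d by rw [hd, one_smul, neg_one_smul]; abel] at key
  rw [key, sahiE_five_of_pairwise_annihilator μ nd k w x y hkx hky hxy e2xy e2kx e2ky e3]
  ring

end Abstract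

end Summit.CriticalPhenomena.PercolationContinuityZ3.Theorems
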